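import Summits.ResolutionOfSingularities.ResolutionOfSingularities.Theorems.HilbertSamuelEliminationCampaignW42ToricMarkedLamCurve
import Summits.ResolutionOfSingularities.ResolutionOfSingularities.Theorems.HilbertSamuelEliminationCampaignW42ToricMarkedLamPoint
import Summits.ResolutionOfSingularities.ResolutionOfSingularities.Theorems.HilbertSamuelEliminationCampaignW42ToricMarkedDescent

/-!
# [OURS · L1 W4.2] Toric marked monomial objects in dimension 3 — brick 6C: THE PHASE LEMMA and the MAIN THEOREM `eresolvable`

[OURS · L1 W4.2 · seat res-L1-s42-pv-2 gen 5] Memo `L/res-L1-s42-pv-2/CALIBRATION-W42-O2-v4.md` §3.  The last step of the existence proof of toric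
order reduction for marked MONOMIAL ideals on smooth toric threefolds (= E-resolution of the monomial binomial basic object along E of Blanco 2012 /
Encinas–Villamayor, = the corner puzzle of a W-top position in the id-based model `…ToricMarkedDefs`): the `θs`-corners `thCones`, the phase measure
`mu` (multiset of the potentials `Λ`), invariance of `Λ` at untouched corners, the DESCENT STEP `mu_move_dm` (Dershowitz–Manna via brick 6B, using the
per-move decreases of bricks 5B), ONE STEP OF PROCEDURE Q `exists_Q_step` (blow up an admissible curve of full residual order if there is one, else a
`θs`-corner), the PHASE LEMMA `phaseLemma_holds : PhaseLemma ι m` by well-founded induction, and the **MAIN THEOREM `eresolvable`: every well-formed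
state with non-negative exponents is E-resolvable by legal blow-ups** (with `eresolvable_initial` for initial corners).  What this does NOT yet give:
the row `IdeasL1Idea2R8.InitialCornerSolvable` itself, which is stated on `HStage` (rays named by vectors, `Won = ≤`, activity clause) — the two bridges
of memo §4.  NOT a statement of the manuscript under review nor of Blanco / Encinas–Villamayor; nothing here claims resolution of singularities in
characteristic `p`.  AI work, weaker than expert review.  No `sorry`, no new axiom.
-/

set_option linter.dupNamespace false -- mandated namespace of this single-conjunct summit

namespace Summit.ResolutionOfSingularities.ResolutionOfSingularities.Theorems.CampaignW42.Toric

namespace TState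

open Finset

variable {ι : Type} [Fintype ι] [Nonempty ι] [DecidableEq ι]

/-! ### The `θs`-corners and the Dershowitz–Manna measure -/

open Classical in
/-- **[OURS · L1 W4.2]** The unresolved corners of residual order exactly `θs` (the «`θs`-corners» of the phase). -/
noncomputable def thCones (m : ℕ) (θs : ℤ) (s : TState ι) : Finset (Finset ℕ) :=
  s.cones.filter (fun C => ¬ s.Resolved m C ∧ s.thetaR C = θs)

/-- **[OURS · L1 W4.2]** The phase measure: the multiset of the potentials `Λ(C)` of the `θs`-corners. -/
noncomputable def mu (m : ℕ) (θs L : ℤ) (s : TState ι) : Multiset (ℕ ×ₗ (ℕ ×ₗ ℕ)) :=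
  (s.thCones m θs).val.map (s.Lam m θs L)

omit [DecidableEq ι] in
open Classical in
/-- Membership in the set of `θs`-corners. -/
theorem mem_thCones {m : ℕ} {θs : ℤ} {s : TState ι} {C : Finset ℕ} :
    C ∈ s.thCones m θs ↔ C ∈ s.cones ∧ ¬ s.Resolved m C ∧ s.thetaR C = θs := by
  unfold thCones; rw [Finset.mem_filter]

/-! ### Untouched corners keep their data -/

omit [DecidableEq ι] in
/-- `K` of a corner avoiding the new ray is unchanged by a blow-up. -/
theorem Kset_move_of_not_mem {m : ℕ} {s : TState ι} {R C : Finset ℕ} (hC : s.next ∉ C) :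
    (s.move m R).Kset C = s.Kset C := by
  ext r
  rw [mem_Kset, mem_Kset]
  have hmin : ∀ v, (s.move m R).IsMinimizer C v ↔ s.IsMinimizer C v := by
    intro v; unfold IsMinimizer
    rw [alphaSum_move_of_not_mem hC, thetaR_move_of_not_mem hC]
  constructor
  · rintro ⟨hr, v, hv, hpos⟩
    have hrn : r ≠ s.next := fun h => hC (h ▸ hr)
    exact ⟨hr, v, (hmin v).mp hv, by rwa [alpha_move_of_ne hrn] at hpos⟩
  · rintro ⟨hr, v, hv, hpos⟩
    have hrn : r ≠ s.next := fun h => hC (h ▸ hr)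
    exact ⟨hr, v, (hmin v).mpr hv, by rwa [alpha_move_of_ne hrn]⟩

omit [DecidableEq ι] in
/-- `k(C)` of a corner avoiding the new ray is unchanged by a blow-up. -/
theorem kmin_move_of_not_mem {m : ℕ} {s : TState ι} {R C : Finset ℕ} (hC : s.next ∉ C) :
    (s.move m R).kmin C = s.kmin C := by
  unfold kmin; simp only [Kset_move_of_not_mem hC]

omit [DecidableEq ι] in
/-- The scaled exponents at old rays, as functions, are unchanged by a blow-up. -/
theorem E2_move_fun_of_ne {m : ℕ} {s : TState ι} {R : Finset ℕ} {θs L : ℤ} {k r : ℕ} (hk : k ≠ s.next) (hr : r ≠ s.next) :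
    (s.move m R).E2 m θs L k r = s.E2 m θs L k r :=
  funext (fun g => E2_move_of_ne hk hr g)

/-- `β₂` at old rays (read at an old ray `k`) is unchanged by a blow-up. -/
theorem bmin2_move_of_ne {m : ℕ} {s : TState ι} {R : Finset ℕ} {θs L : ℤ} {k r : ℕ} (hk : k ≠ s.next) (hr : r ≠ s.next) :
    (s.move m R).bmin2 m θs L k r = s.bmin2 m θs L k r := by
  unfold bmin2; rw [G2_move hk, E2_move_fun_of_ne hk hr]

/-- **Untouched corners keep their potential.**  For a `θs`-corner `C` (positive residual order) avoiding the new ray, `Λ` is unchanged. -/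
theorem Lam_move_of_not_mem {m : ℕ} {s : TState ι} {R C : Finset ℕ} {θs L : ℤ} (hC : s.next ∉ C) (hpos : 0 < s.thetaR C) :
    (s.move m R).Lam m θs L C = s.Lam m θs L C := by
  have hk : s.kmin C ∈ C := kmin_mem_cone hpos
  have hkn : s.kmin C ≠ s.next := fun h => hC (h ▸ hk)
  unfold Lam
  rw [Kset_move_of_not_mem hC, kmin_move_of_not_mem hC]
  have hT : (s.move m R).linkT m θs L (s.kmin C) C = s.linkT m θs L (s.kmin C) C := by
    unfold linkT
    by_cases hne : (C.erase (s.kmin C)).Nonempty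
    · rw [dif_pos hne, dif_pos hne, G2_move hkn]
      have h1 : (C.erase (s.kmin C)).min' hne ≠ s.next :=
        fun h => hC (h ▸ Finset.mem_of_mem_erase (Finset.min'_mem _ hne))
      have h2 : (C.erase (s.kmin C)).max' hne ≠ s.next :=
        fun h => hC (h ▸ Finset.mem_of_mem_erase (Finset.max'_mem _ hne))
      rw [E2_move_fun_of_ne hkn h1, E2_move_fun_of_ne hkn h2]
    · rw [dif_neg hne, dif_neg hne]
  have hP : (s.move m R).psum2 m θs L (s.kmin C) C = s.psum2 m θs L (s.kmin C) C := by
    unfold psum2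
    exact Finset.sum_congr rfl (fun r hr => bmin2_move_of_ne hkn (fun h => hC (h ▸ Finset.mem_of_mem_erase hr)))
  rw [hT, hP]

/-! ### The measure drops at every Q-move -/

/-- **DESCENT STEP.**  Let `R` be a legal face of full residual order `θs` in a state satisfying the phase invariant, and suppose every
`θs`-child of every `θs`-corner containing `R` has strictly smaller potential than its parent.  Then the phase measure of the blown-up state is
Dershowitz–Manna-below that of the state. -/
theorem mu_move_dm {m : ℕ} {s : TState ι} {θs L : ℤ} (hθ : 0 < θs) (h : s.PhaseInv m θs) {R : Finset ℕ} (hlegal : s.Legal m R)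
    (hR : s.thetaR R = θs)
    (HB : ∀ C ∈ s.thCones m θs, R ⊆ C → ∀ x ∈ R, insert s.next (C.erase x) ∈ (s.move m R).thCones m θs →
      (s.move m R).Lam m θs L (insert s.next (C.erase x)) < s.Lam m θs L C) :
    Descent.DM (· < ·) ((s.move m R).mu m θs L) (s.mu m θs L) := by
  classical
  obtain ⟨hwf, hnn, hθle⟩ := h
  set s' := s.move m R with hs'
  -- touched / untouched θs-corners
  set I : Finset (Finset ℕ) := (s.thCones m θs).filter (fun C => R ⊆ C) with hIdef
  set U : Finset (Finset ℕ) := (s.thCones m θs).filter (fun C => ¬ R ⊆ C) with hUdef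
  set B : Finset ℕ → Multiset (ℕ ×ₗ (ℕ ×ₗ ℕ)) :=
    fun C => ((s'.thCones m θs).filter (fun D => ∃ x ∈ R, D = insert s.next (C.erase x))).val.map (s'.Lam m θs L) with hBdef
  -- (1) the old measure splits
  have hmu : s.mu m θs L = U.val.map (s.Lam m θs L) + I.val.map (s.Lam m θs L) := by
    unfold mu
    rw [← Multiset.map_add]
    congr 1
    rw [hUdef, hIdef, Finset.filter_val, Finset.filter_val, add_comm]
    exact (Multiset.filter_add_not _ _).symm
  -- (2) some θs-corner contains R
  have hI : I.val ≠ 0 := by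
    obtain ⟨-, C, hC, hRC⟩ := hlegal.1
    have hnr : ¬ s.Resolved m C := not_resolved_of_legal_subset hnn hlegal hRC
    have hθC : s.thetaR C = θs := thetaR_eq_of_subset ⟨hwf, hnn, hθle⟩ hC hRC hR hlegal
    have hCI : C ∈ I := by
      rw [hIdef, Finset.mem_filter, mem_thCones]; exact ⟨⟨hC, hnr, hθC⟩, hRC⟩
    intro h0
    have : C ∈ I.val := hCI
    rw [h0] at this
    exact Multiset.notMem_zero _ this
  -- (3) children are smaller
  have hBlt : ∀ C ∈ I.val, ∀ b ∈ B C, b < s.Lam m θs L C := by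
    intro C hC b hb
    have hC' : C ∈ I := hC
    rw [hIdef, Finset.mem_filter] at hC'
    rw [hBdef] at hb
    simp only [Multiset.mem_map, Finset.mem_val, Finset.mem_filter] at hb
    obtain ⟨D, ⟨hD, x, hx, rfl⟩, rfl⟩ := hb
    exact HB C hC'.1 hC'.2 x hx hD
  -- (4) the new measure is dominated
  have hnew : ∀ D ∈ s'.thCones m θs, D ∈ U ∨ ∃ C ∈ I, D ∈ (s'.thCones m θs).filter (fun D => ∃ x ∈ R, D = insert s.next (C.erase x)) := by
    intro D hD
    have hD' := hD
    rw [mem_thCones] at hD'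
    obtain ⟨hDc, hDnr, hDθ⟩ := hD'
    rw [hs', mem_move_cones] at hDc
    obtain ⟨C, hC, hDC⟩ := hDc
    have hnC : s.next ∉ C := hwf.next_notMem hC
    by_cases hRC : R ⊆ C
    · right
      rw [children_of_subset hRC, Finset.mem_image] at hDC
      obtain ⟨x, hx, rfl⟩ := hDC
      have hnr : ¬ s.Resolved m C := not_resolved_of_legal_subset hnn hlegal hRC
      have hθC : s.thetaR C = θs := thetaR_eq_of_subset ⟨hwf, hnn, hθle⟩ hC hRC hR hlegal
      refine ⟨C, ?_, ?_⟩
      · rw [hIdef, Finset.mem_filter, mem_thCones]; exact ⟨⟨hC, hnr, hθC⟩, hRC⟩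
      · rw [Finset.mem_filter]; exact ⟨hD, x, hx, rfl⟩
    · left
      rw [children_of_not_subset hRC, Finset.mem_singleton] at hDC
      subst hDC
      rw [hUdef, Finset.mem_filter, mem_thCones]
      refine ⟨⟨hC, fun hr => hDnr ((resolved_move_iff_of_not_mem hnC).mpr hr), ?_⟩, hRC⟩
      rw [← hDθ, hs', thetaR_move_of_not_mem hnC]
  have hsub : s'.thCones m θs ⊆ U ∪ I.biUnion (fun C => (s'.thCones m θs).filter (fun D => ∃ x ∈ R, D = insert s.next (C.erase x))) := by
    intro D hD
    rcases hnew D hD with hU | ⟨C, hC, hDC⟩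
    · exact Finset.mem_union_left _ hU
    · exact Finset.mem_union_right _ (Finset.mem_biUnion.mpr ⟨C, hC, hDC⟩)
  have hUeq : U.val.map (s'.Lam m θs L) = U.val.map (s.Lam m θs L) := by
    apply Multiset.map_congr rfl
    intro C hC
    have hC' : C ∈ U := hC
    rw [hUdef, Finset.mem_filter, mem_thCones] at hC'
    have hnC : s.next ∉ C := hwf.next_notMem hC'.1.1
    have hpos : 0 < s.thetaR C := by rw [hC'.1.2.2]; exact hθ
    exact Lam_move_of_not_mem hnC hpos
  have hle : s'.mu m θs L ≤ U.val.map (s.Lam m θs L) + I.val.bind B := by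
    unfold mu
    calc (s'.thCones m θs).val.map (s'.Lam m θs L)
        ≤ ((U ∪ I.biUnion (fun C => (s'.thCones m θs).filter
            (fun D => ∃ x ∈ R, D = insert s.next (C.erase x)))).val).map (s'.Lam m θs L) :=
          Multiset.map_le_map (Finset.val_le_iff.mpr hsub)
      _ ≤ (U.val + (I.biUnion (fun C => (s'.thCones m θs).filter
            (fun D => ∃ x ∈ R, D = insert s.next (C.erase x)))).val).map (s'.Lam m θs L) := by
          apply Multiset.map_le_map
          rw [Finset.union_val]; exact Multiset.union_le_add _ _
      _ ≤ (U.val + I.val.bind (fun C => ((s'.thCones m θs).filter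
            (fun D => ∃ x ∈ R, D = insert s.next (C.erase x))).val)).map (s'.Lam m θs L) := by
          apply Multiset.map_le_map
          rw [Finset.biUnion_val]
          exact add_le_add_right (Multiset.dedup_le (I.val.bind (fun C => ((s'.thCones m θs).filter
            (fun D => ∃ x ∈ R, D = insert s.next (C.erase x))).val))) _
      _ = U.val.map (s.Lam m θs L) + I.val.bind B := by
          rw [Multiset.map_add, hUeq, Multiset.map_bind]
  rw [hmu]
  exact Descent.dm_of_le_replace _ _ _ _ hBlt hI hle

/-! ### The phase lemma -/

omit [Fintype ι] [Nonempty ι] [DecidableEq ι] in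
/-- A point move on a `θs`-corner touches no other corner: a corner containing another corner of the same size is equal to it. -/
theorem eq_of_cone_subset {s : TState ι} (hwf : s.WF) {C C' : Finset ℕ} (hC : C ∈ s.cones) (hC' : C' ∈ s.cones) (h : C ⊆ C') :
    C = C' :=
  Finset.eq_of_subset_of_card_le h (by rw [(hwf C hC).1, (hwf C' hC').1])

/-- **ONE STEP OF PROCEDURE Q.**  In the phase of residual order `θs > 0`, if some `θs`-corner exists then some legal blow-up of a face of full
residual order makes the phase measure Dershowitz–Manna-smaller: blow up an admissible 2-face if there is one, else a `θs`-corner. -/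
theorem exists_Q_step {m : ℕ} {s : TState ι} {θs L : ℤ} (hθ : 0 < θs) (hL : CommonMult m θs L) (h : s.PhaseInv m θs)
    (hex : (s.thCones m θs).Nonempty) :
    ∃ R, s.Legal m R ∧ s.thetaR R = θs ∧ Descent.DM (· < ·) ((s.move m R).mu m θs L) (s.mu m θs L) := by
  classical
  obtain ⟨hwf, hnn, hθle⟩ := h
  by_cases hcurve : ∃ C ∈ s.thCones m θs, ∃ a ∈ C, ∃ b ∈ C, a ≠ b ∧ s.Admissible m θs {a, b}
  · obtain ⟨C₀, -, a, -, b, -, hab, hadm⟩ := hcurve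
    refine ⟨{a, b}, hadm.legal hnn, hadm.2.1, mu_move_dm hθ ⟨hwf, hnn, hθle⟩ (hadm.legal hnn) hadm.2.1 ?_⟩
    intro C hC habC x hx hD
    rw [mem_thCones] at hC hD
    exact Lam_lt_of_curve_move hnn hwf hθ hL hab hadm hC.1 habC hC.2.2 hx hD.2.2
  · obtain ⟨C₀, hC₀⟩ := hex
    have hC₀' := hC₀
    rw [mem_thCones] at hC₀'
    obtain ⟨hC₀c, hnr, hθC₀⟩ := hC₀'
    have hne : C₀.Nonempty := Finset.card_pos.mp (by rw [(hwf C₀ hC₀c).1]; decide)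
    have hadm : s.Admissible m θs C₀ := admissible_self hC₀c hne hθC₀ hnr
    have hnoadm : ∀ a ∈ C₀, ∀ b ∈ C₀, a ≠ b → ¬ s.Admissible m θs {a, b} :=
      fun a ha b hb hab hab' => hcurve ⟨C₀, hC₀, a, ha, b, hb, hab, hab'⟩
    refine ⟨C₀, hadm.legal hnn, hθC₀, mu_move_dm hθ ⟨hwf, hnn, hθle⟩ (hadm.legal hnn) hθC₀ ?_⟩
    intro C hC hCC x hx hD
    rw [mem_thCones] at hC hD
    have hCeq : C₀ = C := eq_of_cone_subset hwf hC₀c hC.1 hCC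
    subst hCeq
    exact Lam_lt_of_point_move hnn hwf hθ hL hC₀c hθC₀ hnr hnoadm hx hD.2.2

/-- A common multiple of the denominators exists (the factorial). -/
theorem exists_commonMult (m : ℕ) (θs : ℤ) : ∃ L, CommonMult m θs L := by
  refine ⟨((max θs m).toNat.factorial : ℕ), ?_, fun d hd hdle => ?_⟩
  · exact_mod_cast Nat.factorial_pos _
  · have hd' : d = ((d.toNat : ℕ) : ℤ) := (Int.toNat_of_nonneg hd.le).symm
    rw [hd']
    exact_mod_cast Nat.dvd_factorial (by omega) (by omega)

/-- **[OURS · L1 W4.2] THE PHASE LEMMA** (discharging the hypothesis of brick 6A): from the phase invariant at a positive residual level, legal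
blow-ups (procedure Q) reach a state all of whose unresolved corners have residual order `< θs`. -/
theorem phaseLemma_holds (m : ℕ) : PhaseLemma ι m := by
  classical
  intro θs s hθ h
  obtain ⟨L, hL⟩ := exists_commonMult m θs
  -- well-founded induction on the phase measure
  have wf := (Descent.wellFounded_dm (r := fun a b : ℕ ×ₗ (ℕ ×ₗ ℕ) => a < b) wellFounded_lt)
  suffices H : ∀ (M : Multiset (ℕ ×ₗ (ℕ ×ₗ ℕ))) (s : TState ι), s.mu m θs L = M → s.PhaseInv m θs →
      ∃ t, s.Play m t ∧ t.PhaseInv m θs ∧ ∀ C ∈ t.cones, ¬ t.Resolved m C → t.thetaR C < θs from H _ s rfl h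
  intro M
  induction M using wf.induction with
  | _ M ih =>
    intro s hsM hs
    by_cases hex : (s.thCones m θs).Nonempty
    · obtain ⟨R, hlegal, hR, hdm⟩ := exists_Q_step hθ hL hs hex
      rw [hsM] at hdm
      obtain ⟨t, hplay, ht, hlt⟩ := ih _ hdm (s.move m R) rfl (hs.move hR hlegal)
      exact ⟨t, Play.step R hlegal hplay, ht, hlt⟩
    · refine ⟨s, Play.refl s, hs, fun C hC hnr => ?_⟩
      have hle := hs.2.2 C hC hnr
      rcases lt_or_eq_of_le hle with hlt | heq
      · exact hlt
      · exact absurd ⟨C, mem_thCones.mpr ⟨hC, hnr, heq⟩⟩ hex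

/-- **[OURS · L1 W4.2] MAIN THEOREM — toric order reduction of marked monomial ideals in dimension 3 (E-resolution of every toric marked monomial
object; the corner puzzle of every W-top position is E-resolvable in the id-based model).**  Every well-formed state with non-negative exponents is
E-resolvable by legal blow-ups. -/
theorem eresolvable {m : ℕ} (hm : 0 < m) (s : TState ι) (hwf : s.WF) (hnn : s.Nonneg) : s.EResolvable m :=
  eresolvable_of_phaseLemma' hm (phaseLemma_holds m) s hwf hnn

/-- **Corollary.**  The initial corner of every position with non-negative exponents is E-resolvable. -/
theorem eresolvable_initial {m : ℕ} (hm : 0 < m) (a : Fin 3 → ι → ℤ) (ha : ∀ k v, 0 ≤ a k v) : (initial a).EResolvable m :=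
  eresolvable hm _ (initial_WF a) (initial_nonneg a ha)

end TState

end Summit.ResolutionOfSingularities.ResolutionOfSingularities.Theorems.CampaignW42.Toric
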